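import Summits.ABC.IUTFork.Repair.RHHeightScalingBarrier
import HarnessLib

/-!
# R-H ROUND 3, AXIS D2 — THE MIXED BARRIER: an exponent-0 profile recovering a height-free FRACTION `c < 1` of the mass, adjoined to ANY
# barrier family, still never closes the requirement — from an explicit height on (PROOF-ONLY, 0 definitions)

abc-iut cell, rung LADDER-ABC:A2.RESCUE.H, round-3 AXIS D2 (21-frontier 2026-08-27T11:38:40Z; D-0130; KEY D2-TYPE-BARRIER). Seat abc-iut-rh2-w-2 (typer 1 of 2,
BARRIER); sequel of this seat's p531802 `Repair/RHHeightScalingBarrier.lean` (`PowerBoundFrom`, `ClosedBy`, `NeverClosedFrom`, `barrierScale`,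
`suppliedMass_lt_requirement_of_barrierScale_le`, `barrierScale_le_iff_aux`). SOURCE OF THE STATEMENT: abc-iut-rh3-tst-2 g13's D2-REFUTE-2 kernel read
(STATUS 2026-08-27T13:18:46Z, probe `HOME/abc-iut-rh3-tst-2/g13/ProbeBarrierScope.lean` c27fda28701a195b: «non-closing is NOT additive — two fraction-½
profiles close together; the three exponent-0 profiles of the typed currency OVERLAP, joint height-free constant `c_tot = μ₀ + f₀(1−μ₀) < 1`; MIXED BARRIER
`neverClosedFrom_cons_of_constFrac_lt_one`») — asked of the typers «in importable shape»; here it is, over the landed vocabulary, nothing restated.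
THE POINT (AXIS-D2 table of record v2 847f33d7a88ff66a, rows 7/8, DOOR column R84): the exponent-0 profiles of OUR typed currency — the licence HYPOTHESIS on a
fixed label fraction (constant `μ₀(κ) < 1`, not bed-witnessed), the mixed-fibre height transfer (bed constant `0`), the k5-type label-1 credit — recover a
height-free FRACTION, not a height-free MASS; they enter as ONE aggregated term `g₀(s) ≤ c·(M₁·s)` with the JOINT constant `c < 1` (tst-2: not the sum of
the three), and the six certified classes as a barrier family with mass exponents `≤ a < 1`. Conclusion: still no closing beyond
`barrierScale ((1−c)·M₁) tol s₁ a A` — the slope left over for the certified classes is `(1−c)·M₁ > 0`, against which their sub-linear masses lose exactly as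
in p531802. Only `c = 1` (the full licence, i.e. the typed Statement taken as hypothesis) escapes (`closedBy_single_of_ge_mass`, recorded for sharpness).
WHAT IS PROVED (namespace `Summit.ABC.IUTFork.Repair.RH.HeightScalingBarrier`, [folklore] real analysis): `constFrac_add_suppliedMass_lt_requirement`,
**`neverClosedFrom_cons_of_constFrac_lt_one`** (family `Fin.cons g₀ f`), **`not_closedBy_cons_of_heightFree_of_constFrac`** (conductor-type sharp form:
no closing at any `s ≥ s₁` with `s > (Σ C_i + tol)/((1−c)·M₁)`), `closedBy_single_of_ge_mass`, and the non-additivity witness `halfMass_pair_closedBy`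
(two fraction-½ terms close at every `s` although each alone never does — why the JOINT constant, not a sum of tokens, is the right hypothesis).
HONEST FRAMING: elementary real analysis about OUR typed object classes; the licence hypothesis / transfer / k5 credit are claim-tagged HYPOTHESIS profiles of
the axis-D2 table, never Literature facts; nothing here asserts that abc is proved or refuted, or that [IUTchIII] Cor. 3.12 / [IUTchIV] Thm. 1.10 holds or
fails at any datum, or takes a side on any author; typed ≠ proved; tested ≠ endorsed.
-/

noncomputable section

open Finset

namespace Summit.ABC.IUTFork.Repair.RH.HeightScalingBarrier

variable {k : ℕ}

/-- **MIXED BARRIER, quantitative**: if `g₀(s) ≤ c·(M₁·s)` for `s ≥ s₁` with `c < 1` (an exponent-0 term recovering a height-free FRACTION `c` of the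
mass) and the family `f` obeys mass laws with exponents `α_i ≤ a < 1` from `s₁` on, then beyond `barrierScale ((1−c)·M₁) tol s₁ a (Σ max(C_i,0))` the
total `g₀ + Σ f_i` is STRICTLY below the requirement `M₁·s − tol`. [folklore] -/
theorem constFrac_add_suppliedMass_lt_requirement {f : Fin k → ℝ → ℝ} {α C : Fin k → ℝ} {g₀ : ℝ → ℝ} {c s₁ a M₁ tol s : ℝ}
    (hM : 0 < M₁) (hc : c < 1) (ha : a < 1) (hα : ∀ i, α i ≤ a)
    (hg : ∀ s' : ℝ, s₁ ≤ s' → g₀ s' ≤ c * (M₁ * s')) (hf : ∀ i, PowerBoundFrom (f i) (α i) (C i) s₁)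
    (hs : barrierScale ((1 - c) * M₁) tol s₁ a (posConstSum C) ≤ s) :
    g₀ s + suppliedMass f s < requirement M₁ tol s := by
  have hM' : 0 < (1 - c) * M₁ := mul_pos (by linarith) hM
  have h1 := suppliedMass_lt_requirement_of_barrierScale_le (tol := tol) hM' ha hα hf hs
  have hs₁ : s₁ ≤ s := (barrierScale_le_iff_aux hs).1.le
  have h2 := hg s hs₁
  unfold requirement at h1 ⊢
  nlinarith

/-- **MIXED BARRIER for the adjoined family** `Fin.cons g₀ f` (the exponent-0 term in slot `0`, the barrier family after it): never closed from
`barrierScale ((1−c)·M₁) tol s₁ a (Σ max(C_i,0))` on — «the licence hypothesis on a fixed label fraction (`μ₀ < 1`) together with every combination of the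
six certified classes still does not close the requirement at any height `≥ h₀`», `h₀` explicit; only `c = 1` escapes. [folklore] -/
theorem neverClosedFrom_cons_of_constFrac_lt_one {f : Fin k → ℝ → ℝ} {α C : Fin k → ℝ} {g₀ : ℝ → ℝ} {c s₁ a M₁ tol : ℝ}
    (hM : 0 < M₁) (hc : c < 1) (ha : a < 1) (hα : ∀ i, α i ≤ a)
    (hg : ∀ s' : ℝ, s₁ ≤ s' → g₀ s' ≤ c * (M₁ * s')) (hf : ∀ i, PowerBoundFrom (f i) (α i) (C i) s₁) :
    NeverClosedFrom (Fin.cons g₀ f) M₁ tol (barrierScale ((1 - c) * M₁) tol s₁ a (posConstSum C)) := by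
  intro s hs h
  have hlt := constFrac_add_suppliedMass_lt_requirement hM hc ha hα hg hf hs
  unfold ClosedBy suppliedMass at h
  rw [Fin.sum_univ_succ] at h
  simp only [Fin.cons_zero, Fin.cons_succ] at h
  unfold suppliedMass at hlt
  linarith

/-- **Conductor-type mixed form, SHARP**: height-free bounds `C_i` for the certified classes plus an exponent-0 fraction `c < 1`: no closing at any `s ≥ s₁`
with `s > (Σ C_i + tol)/((1−c)·M₁)`. [folklore] -/
theorem not_closedBy_cons_of_heightFree_of_constFrac {f : Fin k → ℝ → ℝ} {C : Fin k → ℝ} {g₀ : ℝ → ℝ} {c s₁ M₁ tol s : ℝ}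
    (hM : 0 < M₁) (hc : c < 1) (hg : ∀ s' : ℝ, s₁ ≤ s' → g₀ s' ≤ c * (M₁ * s'))
    (hf : ∀ i, ∀ s' : ℝ, s₁ ≤ s' → f i s' ≤ C i) (hs₁ : s₁ ≤ s) (hs : (∑ i, C i + tol) / ((1 - c) * M₁) < s) :
    ¬ ClosedBy (Fin.cons g₀ f) M₁ tol s := by
  intro h
  have hM' : 0 < (1 - c) * M₁ := mul_pos (by linarith) hM
  have hsum : suppliedMass f s ≤ ∑ i, C i := Finset.sum_le_sum fun i _ => hf i s hs₁
  have hlt : ∑ i, C i + tol < (1 - c) * M₁ * s := by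
    have := mul_lt_mul_of_pos_left hs hM'
    have h1c : (1 - c) ≠ 0 := (sub_pos.mpr hc).ne'
    have h' : (1 - c) * M₁ * ((∑ i, C i + tol) / ((1 - c) * M₁)) = ∑ i, C i + tol := by
      field_simp
    rwa [h'] at this
  have h2 := hg s hs₁
  unfold ClosedBy suppliedMass requirement at h
  rw [Fin.sum_univ_succ] at h
  simp only [Fin.cons_zero, Fin.cons_succ] at h
  unfold suppliedMass at hsum
  nlinarith

/-- **Only the full fraction escapes**: a single exponent-0 term with `g₀(s) ≥ M₁·s` (`c = 1`: the FULL licence = the typed Statement itself as a hypothesis)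
closes the requirement at every `s` (any `tol ≥ 0`) — the trivial door, recorded so that the hypothesis `c < 1` above is seen to be sharp. [folklore] -/
theorem closedBy_single_of_ge_mass {g₀ : ℝ → ℝ} {M₁ tol s : ℝ} (htol : 0 ≤ tol) (hg : M₁ * s ≤ g₀ s) :
    ClosedBy (fun _ : Fin 1 => g₀) M₁ tol s := by
  unfold ClosedBy suppliedMass requirement
  simp only [Finset.univ_unique, Fin.default_eq_zero, Finset.sum_singleton]
  linarith

/-- **Non-closing is NOT additive** (abc-iut-rh3-tst-2's caution, kernel form): two terms each recovering the height-free fraction `½` never close the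
tolerance-free requirement alone from any height where `M₁·s > 0`... yet TOGETHER they close it at every `s` (`tol ≥ 0`). Hence a DOOR/BARRIER verdict for a
combination needs the JOINT constant of the exponent-0 terms, not a list of per-term tokens. [folklore] -/
theorem halfMass_pair_closedBy {M₁ tol s : ℝ} (htol : 0 ≤ tol) :
    ClosedBy (fun _ : Fin 2 => fun s' : ℝ => (1 / 2) * (M₁ * s')) M₁ tol s := by
  unfold ClosedBy suppliedMass requirement
  simp only [Fin.sum_univ_two]
  linarith

/-- … while ONE fraction-½ term never closes the tolerance-free requirement at any `s` with `M₁·s > 0`. [folklore] -/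
theorem halfMass_single_not_closedBy {M₁ s : ℝ} (hMs : 0 < M₁ * s) :
    ¬ ClosedBy (fun _ : Fin 1 => fun s' : ℝ => (1 / 2) * (M₁ * s')) M₁ 0 s := by
  unfold ClosedBy suppliedMass requirement
  simp only [Finset.univ_unique, Fin.default_eq_zero, Finset.sum_singleton, sub_zero]
  linarith

end Summit.ABC.IUTFork.Repair.RH.HeightScalingBarrier

end
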